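import Mathlib
import HarnessLib
import Literature.Analysis.FluidPDE.FluidComputer.GalerkinEnergyBalance
import Literature.Analysis.FluidPDE.FluidComputer.ShellTransferParseval
import Summits.NavierStokesRegularity.FluidComputer.BandSupEnvelope

/-!
# Band sup ceiling on `𝕋³`: `|u_B(x)|² ≤ (4/3)·#B·E_B` (lattice Nikol'skii / Cauchy–Schwarz), and the coherence bookkeeping it supports

HONEST FRAMING (cell `pub-fluidc`, verbatim): *low prior, high value-of-information experiment on
Tao's machine paradigm; NOT a claim that NS blows up.* Nothing here concerns the Navier–Stokes or
Euler evolution. For Fourier coefficients `û : ℤ³ → ℂ³` (`ShellTransfer.FourierVelocity`: real,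
incompressible) and a finite mode set `B`, the trigonometric polynomial `u_B = Σ_{k∈B} û(k) e^{ik·x}`
(`ShellTransfer.field`) obeys at EVERY point, with `E_B = ½ Σ_{k∈B} |û(k)|²` (`ShellTransfer.truncEnergy`):
* `field_normSq_le`: `Σ_j |u_{B,j}(x)|² ≤ 2·#B·E_B` — the vector form of the COMPONENT-wise lattice
  Bernstein/Nikol'skii bound already in the tree (`BandSupEnvelope.norm_field_le_sqrt_card_energy`,
  lit gen 38: `|u_{B,j}| ≤ √#B·√(2E_B)` per component; summing components there costs a factor 3, here 1);
* `dirField_normSq_le`: `|e·u_B(x)|² ≤ 2·(Σ_{k∈B}(|e|² − (e·k)²/|k|²))·E_B` for `0 ∉ B` — incompressibility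
  replaces the direction `e` by its part orthogonal to `k`, mode by mode;
* `sum_dirCos_sq_eq`: `Σ_{k∈B}(e·k)²/|k|² = |e|²·#B/3` for a band closed under coordinate sign changes and
  exchanges (every lattice shell `{a ≤ |k| < b}` is) — isotropy of a cubically symmetric set of directions;
* `dirField_normSq_le_isotropic`, `field_real_normSq_le`: hence **`|u_B(x)|² ≤ (4/3)·#B·E_B`**, the
  ceiling defining the band COHERENCE `φ_B := U_B/√((4/3)#B E_B) ∈ [0,1]` of HOME/LITERATURE.md §A22.71
  (Taylor–Green: `#B = 8`, `E = 1/8`, sup `1 ≤ 1.155`);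
* `coherence_telescope`: the bookkeeping of §A22.71 (d) — if `r_n² = κ² η_n (φ_{n+1}/φ_n)² ≥ 1` at `N`
  consecutive levels with `φ_n ∈ (0,1]`, then `φ_0² ≤ (κ²)^N Π η_n` (coherence gains telescope, so a
  sustained floor is an energy-hand-over condition).
Pure finite-sum algebra in the vocabulary of `Literature.Analysis.FluidPDE.FluidComputer.ShellTransfer`;
filed by the cell's literature seat (pub-fluidc-lit gen 46); no named facts (D-0026).
-/
noncomputable section

namespace Summit.NavierStokesRegularity.FluidComputer.BandSupCeiling

open Complex ComplexConjugate Finset Real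
open Literature.Analysis.FluidPDE.FluidComputer Literature.Analysis.FluidPDE.FluidComputer.ShellTransfer
open scoped BigOperators

variable (U : FourierVelocity)

/-- One component: `|u_{B,j}(x)|² ≤ #B · Σ_{k∈B} |û_j(k)|²` (Cauchy–Schwarz over the modes, `|e^{ik·x}| = 1`).
[folklore] -/
theorem field_component_normSq_le (B : Finset (Fin 3 → ℤ)) (j : Fin 3) (x y z : ℝ) :
    ‖field U B j x y z‖ ^ 2 ≤ (B.card : ℝ) * ∑ k ∈ B, ‖U.coeff k j‖ ^ 2 := by
  have h1 : ‖field U B j x y z‖ ≤ ∑ k ∈ B, ‖U.coeff k j‖ * 1 := by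
    simpa only [mul_one] using BandSupEnvelope.norm_field_le_sum_norm U B j x y z
  have h2 : (∑ k ∈ B, ‖U.coeff k j‖ * 1) ^ 2 ≤ (∑ k ∈ B, ‖U.coeff k j‖ ^ 2) * ∑ k ∈ B, (1 : ℝ) ^ 2 :=
    Finset.sum_mul_sq_le_sq_mul_sq _ _ _
  have h3 : ∑ k ∈ B, (1 : ℝ) ^ 2 = (B.card : ℝ) := by simp
  calc ‖field U B j x y z‖ ^ 2 ≤ (∑ k ∈ B, ‖U.coeff k j‖ * 1) ^ 2 :=
        pow_le_pow_left₀ (norm_nonneg _) h1 2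
    _ ≤ (∑ k ∈ B, ‖U.coeff k j‖ ^ 2) * ∑ k ∈ B, (1 : ℝ) ^ 2 := h2
    _ = (B.card : ℝ) * ∑ k ∈ B, ‖U.coeff k j‖ ^ 2 := by rw [h3, mul_comm]

/-- `2 E_B = Σ_{k∈B} Σ_j |û_j(k)|²` in terms of norms. [folklore] -/
theorem two_mul_truncEnergy (B : Finset (Fin 3 → ℤ)) :
    2 * truncEnergy U B = ∑ k ∈ B, ∑ j, ‖U.coeff k j‖ ^ 2 := by
  unfold truncEnergy modalEnergy; rw [Finset.mul_sum]
  refine Finset.sum_congr rfl fun k _ => ?_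
  rw [← mul_assoc]; norm_num; exact Finset.sum_congr rfl fun j _ => Complex.normSq_eq_norm_sq _

/-- **Nikol'skii ceiling for a band-limited field** (crude form, no incompressibility used):
`Σ_j |u_{B,j}(x)|² ≤ 2 · #B · E_B` at every point of the cell. [folklore] -/
theorem field_normSq_le (B : Finset (Fin 3 → ℤ)) (x y z : ℝ) :
    ∑ j, ‖field U B j x y z‖ ^ 2 ≤ 2 * (B.card : ℝ) * truncEnergy U B := by
  calc ∑ j, ‖field U B j x y z‖ ^ 2 ≤ ∑ j, (B.card : ℝ) * ∑ k ∈ B, ‖U.coeff k j‖ ^ 2 :=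
        Finset.sum_le_sum fun j _ => field_component_normSq_le U B j x y z
    _ = (B.card : ℝ) * ∑ k ∈ B, ∑ j, ‖U.coeff k j‖ ^ 2 := by
        rw [← Finset.mul_sum, Finset.sum_comm]
    _ = 2 * (B.card : ℝ) * truncEnergy U B := by
        rw [← two_mul_truncEnergy]; ring

/-- `e · k` for a real direction `e ∈ ℝ³` and a wavevector `k ∈ ℤ³`. [folklore] -/
def edot (e : Fin 3 → ℝ) (k : Fin 3 → ℤ) : ℝ := ∑ i, e i * ((k i : ℤ) : ℝ)

/-- `|e|²`. [folklore] -/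
def enormSq (e : Fin 3 → ℝ) : ℝ := ∑ i, e i ^ 2

/-- The component of `e` orthogonal to `k ≠ 0`: `e − ((e·k)/|k|²) k`. [folklore] -/
def perp (e : Fin 3 → ℝ) (k : Fin 3 → ℤ) (j : Fin 3) : ℝ :=
  e j - edot e k / knormSq k * ((k j : ℤ) : ℝ)

/-- The field `u_B` read in the direction `e`: `e · u_B(x) = Σ_j e_j u_{B,j}(x)`. [folklore] -/
def dirField (e : Fin 3 → ℝ) (B : Finset (Fin 3 → ℤ)) (x y z : ℝ) : ℂ :=
  ∑ j, ((e j : ℝ) : ℂ) * field U B j x y z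

/-- `|k|² > 0` for `k ≠ 0`. [folklore] -/
theorem knormSq_pos_of_ne_zero {k : Fin 3 → ℤ} (hk : k ≠ 0) : 0 < knormSq k := by
  obtain ⟨i, hi⟩ := Function.ne_iff.mp hk
  have hi' : ((k i : ℤ) : ℝ) ≠ 0 := by exact_mod_cast hi
  exact Finset.sum_pos' (fun j _ => sq_nonneg _) ⟨i, Finset.mem_univ _, by positivity⟩

/-- `|e_⊥|² = |e|² − (e·k)²/|k|²` for `k ≠ 0`. [folklore] -/
theorem sum_perp_sq (e : Fin 3 → ℝ) {k : Fin 3 → ℤ} (hk : k ≠ 0) :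
    ∑ j, perp e k j ^ 2 = enormSq e - edot e k ^ 2 / knormSq k := by
  have hn : knormSq k ≠ 0 := (knormSq_pos_of_ne_zero hk).ne'
  unfold perp enormSq edot knormSq at *
  simp only [Fin.sum_univ_three] at *
  field_simp
  ring

/-- Incompressibility lets the direction be replaced by its part orthogonal to `k`:
`Σ_j e_j û_j(k) = Σ_j (e_⊥)_j û_j(k)` (for `k = 0` both sides agree trivially, `e_⊥ = e`). [derived] -/
theorem sum_dir_coeff_eq_perp (e : Fin 3 → ℝ) (k : Fin 3 → ℤ) :
    ∑ j, ((e j : ℝ) : ℂ) * U.coeff k j = ∑ j, ((perp e k j : ℝ) : ℂ) * U.coeff k j := by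
  have hdiv : ∑ j, ((k j : ℤ) : ℂ) * U.coeff k j = 0 := U.divFree k
  have : ∑ j, ((perp e k j : ℝ) : ℂ) * U.coeff k j
      = ∑ j, ((e j : ℝ) : ℂ) * U.coeff k j
        - ((edot e k / knormSq k : ℝ) : ℂ) * ∑ j, ((k j : ℤ) : ℂ) * U.coeff k j := by
    rw [Finset.mul_sum, ← Finset.sum_sub_distrib]
    refine Finset.sum_congr rfl fun j _ => ?_
    unfold perp
    push_cast
    ring
  rw [this, hdiv, mul_zero, sub_zero]

/-- One mode, Cauchy–Schwarz over the three components: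
`|Σ_j (e_⊥)_j û_j(k)|² ≤ |e_⊥|² · Σ_j |û_j(k)|²`. [folklore] -/
theorem normSq_sum_perp_coeff_le (e : Fin 3 → ℝ) (k : Fin 3 → ℤ) :
    ‖∑ j, ((perp e k j : ℝ) : ℂ) * U.coeff k j‖ ^ 2
      ≤ (∑ j, perp e k j ^ 2) * ∑ j, ‖U.coeff k j‖ ^ 2 := by
  have h1 : ‖∑ j, ((perp e k j : ℝ) : ℂ) * U.coeff k j‖ ≤ ∑ j, |perp e k j| * ‖U.coeff k j‖ := by
    refine (norm_sum_le _ _).trans (Finset.sum_le_sum fun j _ => ?_)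
    rw [norm_mul, Complex.norm_real, Real.norm_eq_abs]
  have h2 := Finset.sum_mul_sq_le_sq_mul_sq (Finset.univ : Finset (Fin 3))
    (fun j => |perp e k j|) (fun j => ‖U.coeff k j‖)
  have h0 : 0 ≤ ∑ j, |perp e k j| * ‖U.coeff k j‖ :=
    Finset.sum_nonneg fun j _ => mul_nonneg (abs_nonneg _) (norm_nonneg _)
  calc ‖∑ j, ((perp e k j : ℝ) : ℂ) * U.coeff k j‖ ^ 2
      ≤ (∑ j, |perp e k j| * ‖U.coeff k j‖) ^ 2 := pow_le_pow_left₀ (norm_nonneg _) h1 2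
    _ ≤ (∑ j, |perp e k j| ^ 2) * ∑ j, ‖U.coeff k j‖ ^ 2 := h2
    _ = (∑ j, perp e k j ^ 2) * ∑ j, ‖U.coeff k j‖ ^ 2 := by simp [sq_abs]

/-- The directional field as ONE trigonometric sum: `e·u_B(x) = Σ_{k∈B} (e·û(k)) e^{ik·x}`. [folklore] -/
theorem dirField_eq_sum (e : Fin 3 → ℝ) (B : Finset (Fin 3 → ℤ)) (x y z : ℝ) :
    dirField U e B x y z = ∑ k ∈ B, (∑ j, ((e j : ℝ) : ℂ) * U.coeff k j) * wave k x y z := by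
  unfold dirField field; simp only [Finset.mul_sum, Finset.sum_mul]; rw [Finset.sum_comm]
  exact Finset.sum_congr rfl fun k _ => Finset.sum_congr rfl fun j _ => by ring

/-- **Divergence-free directional ceiling**: for a band `B` not containing the zero mode and any
real direction `e`, `|e · u_B(x)|² ≤ 2 · (Σ_{k∈B} (|e|² − (e·k)²/|k|²)) · E_B` at every point.
[derived — Cauchy–Schwarz over the modes with the weights `|e_⊥(k)|`, after `sum_dir_coeff_eq_perp`] -/
theorem dirField_normSq_le (e : Fin 3 → ℝ) (B : Finset (Fin 3 → ℤ)) (hB : ∀ k ∈ B, k ≠ 0)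
    (x y z : ℝ) :
    ‖dirField U e B x y z‖ ^ 2
      ≤ 2 * (∑ k ∈ B, (enormSq e - edot e k ^ 2 / knormSq k)) * truncEnergy U B := by
  set A : (Fin 3 → ℤ) → ℝ := fun k => ∑ j, perp e k j ^ 2 with hA
  set C : (Fin 3 → ℤ) → ℝ := fun k => ∑ j, ‖U.coeff k j‖ ^ 2 with hC
  have hA0 : ∀ k, 0 ≤ A k := fun k => Finset.sum_nonneg fun j _ => sq_nonneg _
  have hC0 : ∀ k, 0 ≤ C k := fun k => Finset.sum_nonneg fun j _ => sq_nonneg _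
  have hmode : ∀ k ∈ B, ‖(∑ j, ((e j : ℝ) : ℂ) * U.coeff k j) * wave k x y z‖
      ≤ Real.sqrt (A k) * Real.sqrt (C k) := by
    intro k _
    rw [norm_mul, BandSupEnvelope.norm_wave, mul_one, sum_dir_coeff_eq_perp U e k, ← Real.sqrt_mul (hA0 k)]
    apply Real.le_sqrt_of_sq_le
    exact normSq_sum_perp_coeff_le U e k
  have h1 : ‖dirField U e B x y z‖ ≤ ∑ k ∈ B, Real.sqrt (A k) * Real.sqrt (C k) := by
    rw [dirField_eq_sum]
    exact (norm_sum_le _ _).trans (Finset.sum_le_sum hmode)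
  have h2 := Finset.sum_mul_sq_le_sq_mul_sq B (fun k => Real.sqrt (A k)) (fun k => Real.sqrt (C k))
  have hAsum : ∑ k ∈ B, Real.sqrt (A k) ^ 2 = ∑ k ∈ B, (enormSq e - edot e k ^ 2 / knormSq k) := by
    refine Finset.sum_congr rfl fun k hk => ?_
    rw [Real.sq_sqrt (hA0 k)]
    exact sum_perp_sq e (hB k hk)
  have hCsum : ∑ k ∈ B, Real.sqrt (C k) ^ 2 = 2 * truncEnergy U B := by
    rw [two_mul_truncEnergy]
    exact Finset.sum_congr rfl fun k _ => Real.sq_sqrt (hC0 k)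
  calc ‖dirField U e B x y z‖ ^ 2
      ≤ (∑ k ∈ B, Real.sqrt (A k) * Real.sqrt (C k)) ^ 2 := pow_le_pow_left₀ (norm_nonneg _) h1 2
    _ ≤ (∑ k ∈ B, Real.sqrt (A k) ^ 2) * ∑ k ∈ B, Real.sqrt (C k) ^ 2 := h2
    _ = (∑ k ∈ B, (enormSq e - edot e k ^ 2 / knormSq k)) * (2 * truncEnergy U B) := by
        rw [hAsum, hCsum]
    _ = 2 * (∑ k ∈ B, (enormSq e - edot e k ^ 2 / knormSq k)) * truncEnergy U B := by ring

/-- Sign change of the `i`-th coordinate of a wavevector. [folklore] -/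
def flipAt (i : Fin 3) (k : Fin 3 → ℤ) : Fin 3 → ℤ := Function.update k i (-k i)

/-- Exchange of the coordinates `i` and `j` of a wavevector. [folklore] -/
def swapAt (i j : Fin 3) (k : Fin 3 → ℤ) : Fin 3 → ℤ := fun l => k (Equiv.swap i j l)

/-- The flipped coordinate changes sign. -/
theorem flipAt_same (i : Fin 3) (k : Fin 3 → ℤ) : flipAt i k i = -k i := by
  simp [flipAt]

/-- The other coordinates are untouched by the flip. -/
theorem flipAt_of_ne {i l : Fin 3} (h : l ≠ i) (k : Fin 3 → ℤ) : flipAt i k l = k l := by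
  simp [flipAt, Function.update_of_ne h]

/-- A coordinate sign change is an involution. -/
theorem flipAt_flipAt (i : Fin 3) (k : Fin 3 → ℤ) : flipAt i (flipAt i k) = k := by
  funext l
  rcases eq_or_ne l i with rfl | h
  · rw [flipAt_same, flipAt_same, neg_neg]
  · rw [flipAt_of_ne h, flipAt_of_ne h]

/-- A coordinate exchange is an involution. -/
theorem swapAt_swapAt (i j : Fin 3) (k : Fin 3 → ℤ) : swapAt i j (swapAt i j k) = k := by
  funext l
  simp [swapAt, Equiv.swap_apply_self]

/-- `|k|²` is invariant under a coordinate sign change. [folklore] -/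
theorem knormSq_flipAt (i : Fin 3) (k : Fin 3 → ℤ) : knormSq (flipAt i k) = knormSq k := by
  unfold knormSq
  refine Finset.sum_congr rfl fun l _ => ?_
  rcases eq_or_ne l i with rfl | h
  · rw [flipAt_same]; push_cast; ring
  · rw [flipAt_of_ne h]

/-- `|k|²` is invariant under a coordinate exchange. [folklore] -/
theorem knormSq_swapAt (i j : Fin 3) (k : Fin 3 → ℤ) : knormSq (swapAt i j k) = knormSq k := by
  unfold knormSq swapAt
  exact Equiv.sum_comp (Equiv.swap i j) (fun l => ((k l : ℤ) : ℝ) ^ 2)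

/-- The second moment of the directions of a band: `M_{ij} = Σ_{k∈B} k_i k_j / |k|²`. [folklore] -/
def dirMoment (B : Finset (Fin 3 → ℤ)) (i j : Fin 3) : ℝ :=
  ∑ k ∈ B, ((k i : ℤ) : ℝ) * ((k j : ℤ) : ℝ) / knormSq k

/-- A band closed under the sign change of coordinate `i` has `M_{ij} = 0` for `j ≠ i`
(the summand is odd under the flip). [folklore] -/
theorem dirMoment_offDiag (B : Finset (Fin 3 → ℤ)) {i j : Fin 3} (hij : j ≠ i)
    (hflip : ∀ k ∈ B, flipAt i k ∈ B) : dirMoment B i j = 0 := by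
  unfold dirMoment
  set f : (Fin 3 → ℤ) → ℝ := fun k => ((k i : ℤ) : ℝ) * ((k j : ℤ) : ℝ) / knormSq k with hf
  have hodd : ∀ k, f (flipAt i k) = -f k := by
    intro k
    simp only [hf, flipAt_same, flipAt_of_ne hij, knormSq_flipAt]
    push_cast; ring
  have hswap : ∑ k ∈ B, f k = ∑ k ∈ B, f (flipAt i k) :=
    Finset.sum_nbij' (flipAt i) (flipAt i) hflip hflip (fun k _ => flipAt_flipAt i k)
      (fun k _ => flipAt_flipAt i k) (fun k _ => by rw [flipAt_flipAt])
  have hneg : ∑ k ∈ B, f (flipAt i k) = -∑ k ∈ B, f k := by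
    rw [← Finset.sum_neg_distrib]
    exact Finset.sum_congr rfl fun k _ => hodd k
  linarith [hswap, hneg]

/-- A band closed under the exchange of coordinates `i, j` has `M_{ii} = M_{jj}`. [folklore] -/
theorem dirMoment_diag (B : Finset (Fin 3 → ℤ)) (i j : Fin 3)
    (hswap : ∀ k ∈ B, swapAt i j k ∈ B) : dirMoment B i i = dirMoment B j j := by
  unfold dirMoment
  refine Finset.sum_nbij' (swapAt i j) (swapAt i j) hswap hswap (fun k _ => swapAt_swapAt i j k)
    (fun k _ => swapAt_swapAt i j k) (fun k _ => ?_)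
  rw [knormSq_swapAt]
  simp [swapAt, Equiv.swap_apply_right]

/-- Trace: `M_{00} + M_{11} + M_{22} = #B` for a band avoiding the zero mode. [folklore] -/
theorem dirMoment_trace (B : Finset (Fin 3 → ℤ)) (hB : ∀ k ∈ B, k ≠ 0) :
    dirMoment B 0 0 + dirMoment B 1 1 + dirMoment B 2 2 = B.card := by
  unfold dirMoment
  rw [← Finset.sum_add_distrib, ← Finset.sum_add_distrib]
  have : ∀ k ∈ B, ((k 0 : ℤ) : ℝ) * ((k 0 : ℤ) : ℝ) / knormSq k + ((k 1 : ℤ) : ℝ) * ((k 1 : ℤ) : ℝ) / knormSq k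
      + ((k 2 : ℤ) : ℝ) * ((k 2 : ℤ) : ℝ) / knormSq k = 1 := by
    intro k hk
    have hn : knormSq k ≠ 0 := (knormSq_pos_of_ne_zero (hB k hk)).ne'
    have hdef : knormSq k = ((k 0 : ℤ) : ℝ) ^ 2 + ((k 1 : ℤ) : ℝ) ^ 2 + ((k 2 : ℤ) : ℝ) ^ 2 := by
      unfold knormSq; simp [Fin.sum_univ_three]
    rw [← add_div, ← add_div, div_eq_one_iff_eq hn, hdef]; ring
  rw [Finset.sum_congr rfl this]
  simp

/-- **Isotropy of a cubically symmetric band**: if `B ∌ 0` is closed under every coordinate sign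
change and every coordinate exchange (every lattice shell `{a ≤ |k| < b}` is), then for every real
direction `e`, `Σ_{k∈B} (e·k)²/|k|² = |e|² · #B / 3`. [folklore: `Σ_k k̂⊗k̂ = (#B/3)·Id`] -/
theorem sum_dirCos_sq_eq (B : Finset (Fin 3 → ℤ)) (hB : ∀ k ∈ B, k ≠ 0)
    (hflip : ∀ i, ∀ k ∈ B, flipAt i k ∈ B) (hswap : ∀ i j, ∀ k ∈ B, swapAt i j k ∈ B)
    (e : Fin 3 → ℝ) :
    ∑ k ∈ B, edot e k ^ 2 / knormSq k = enormSq e * B.card / 3 := by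
  have hexp : ∀ k, edot e k ^ 2 / knormSq k
      = e 0 ^ 2 * (((k 0 : ℤ) : ℝ) * ((k 0 : ℤ) : ℝ) / knormSq k)
      + e 1 ^ 2 * (((k 1 : ℤ) : ℝ) * ((k 1 : ℤ) : ℝ) / knormSq k)
      + e 2 ^ 2 * (((k 2 : ℤ) : ℝ) * ((k 2 : ℤ) : ℝ) / knormSq k)
      + 2 * (e 0 * e 1) * (((k 0 : ℤ) : ℝ) * ((k 1 : ℤ) : ℝ) / knormSq k)
      + 2 * (e 0 * e 2) * (((k 0 : ℤ) : ℝ) * ((k 2 : ℤ) : ℝ) / knormSq k)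
      + 2 * (e 1 * e 2) * (((k 1 : ℤ) : ℝ) * ((k 2 : ℤ) : ℝ) / knormSq k) := by
    intro k
    unfold edot
    simp only [Fin.sum_univ_three]
    ring
  rw [Finset.sum_congr rfl fun k _ => hexp k]
  simp only [Finset.sum_add_distrib, ← Finset.mul_sum]
  have h01 : dirMoment B 0 1 = 0 := dirMoment_offDiag B (by decide) (hflip 0)
  have h02 : dirMoment B 0 2 = 0 := dirMoment_offDiag B (by decide) (hflip 0)
  have h12 : dirMoment B 1 2 = 0 := dirMoment_offDiag B (by decide) (hflip 1)
  have h00 : dirMoment B 0 0 = dirMoment B 1 1 := dirMoment_diag B 0 1 (hswap 0 1)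
  have h22 : dirMoment B 2 2 = dirMoment B 1 1 := dirMoment_diag B 2 1 (hswap 2 1)
  have htr := dirMoment_trace B hB
  unfold dirMoment at h01 h02 h12 h00 h22 htr
  rw [h01, h02, h12]
  unfold enormSq
  simp only [Fin.sum_univ_three]
  set m := ∑ k ∈ B, ((k 1 : ℤ) : ℝ) * ((k 1 : ℤ) : ℝ) / knormSq k with hm
  rw [h00, h22] at htr ⊢
  have hm3 : m = (B.card : ℝ) / 3 := by linarith
  rw [hm3]; ring

/-- **The band sup ceiling for divergence-free fields** (directional form): for a cubically
symmetric band `B ∌ 0` and any real direction `e`,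
`|e · u_B(x)|² ≤ (4/3) · #B · E_B · |e|²` at every point. For the real physical field,
`|u_B(x)| = sup_{|e|=1} e·u_B(x)`, so `sup_x |u_B| ≤ √((4/3) · #B · E_B)` — the ceiling defining
the band coherence `φ_B` of HOME/LITERATURE.md §A22.71. [derived] -/
theorem dirField_normSq_le_isotropic (e : Fin 3 → ℝ) (B : Finset (Fin 3 → ℤ))
    (hB : ∀ k ∈ B, k ≠ 0) (hflip : ∀ i, ∀ k ∈ B, flipAt i k ∈ B)
    (hswap : ∀ i j, ∀ k ∈ B, swapAt i j k ∈ B) (x y z : ℝ) :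
    ‖dirField U e B x y z‖ ^ 2 ≤ 4 / 3 * (B.card : ℝ) * truncEnergy U B * enormSq e := by
  have h := dirField_normSq_le U e B hB x y z
  have hsum : ∑ k ∈ B, (enormSq e - edot e k ^ 2 / knormSq k) = 2 / 3 * enormSq e * B.card := by
    rw [Finset.sum_sub_distrib, sum_dirCos_sq_eq B hB hflip hswap e]
    simp
    ring
  rw [hsum] at h
  calc ‖dirField U e B x y z‖ ^ 2 ≤ 2 * (2 / 3 * enormSq e * B.card) * truncEnergy U B := h
    _ = 4 / 3 * (B.card : ℝ) * truncEnergy U B * enormSq e := by ring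

/-- **Headline — the band sup ceiling `|u_B(x)|² ≤ (4/3)·#B·E_B`** at every point where the
(complex representation of the) field is real — which is everywhere for a `FourierVelocity`
carried by a band closed under `k ↦ -k` (reality `û(-k) = conj û(k)`); the realness is taken as a
hypothesis here to keep the statement pointwise. With `U_B := sup_x |u_B(x)|` this is
`U_B ≤ √((4/3) #B E_B)`, i.e. the coherence `φ_B = U_B/√((4/3) #B E_B)` of HOME/LITERATURE.md
§A22.71 lies in `[0, 1]`. [derived — `dirField_normSq_le_isotropic` with `e = u_B(x)` itself] -/
theorem field_real_normSq_le (B : Finset (Fin 3 → ℤ)) (hB : ∀ k ∈ B, k ≠ 0)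
    (hflip : ∀ i, ∀ k ∈ B, flipAt i k ∈ B) (hswap : ∀ i j, ∀ k ∈ B, swapAt i j k ∈ B)
    (x y z : ℝ) (hreal : ∀ j, (field U B j x y z).im = 0) :
    ∑ j, (field U B j x y z).re ^ 2 ≤ 4 / 3 * (B.card : ℝ) * truncEnergy U B := by
  set e : Fin 3 → ℝ := fun j => (field U B j x y z).re with he
  have hfield : ∀ j, field U B j x y z = ((e j : ℝ) : ℂ) := by
    intro j
    apply Complex.ext
    · simp [he]
    · simp [hreal j]
  have hdir : dirField U e B x y z = ((enormSq e : ℝ) : ℂ) := by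
    unfold dirField enormSq
    push_cast
    refine Finset.sum_congr rfl fun j _ => ?_
    rw [hfield j]; ring
  have h := dirField_normSq_le_isotropic U e B hB hflip hswap x y z
  rw [hdir, Complex.norm_real, Real.norm_eq_abs, sq_abs] at h
  have hE : 0 ≤ enormSq e := Finset.sum_nonneg fun j _ => sq_nonneg _
  have hgoal : enormSq e ≤ 4 / 3 * (B.card : ℝ) * truncEnergy U B := by
    rcases hE.lt_or_eq with hpos | hzero
    · exact le_of_mul_le_mul_right (by linarith [h]) hpos
    · rw [← hzero]
      exact mul_nonneg (mul_nonneg (by norm_num) (Nat.cast_nonneg _))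
        (Finset.sum_nonneg fun k _ => modalEnergy_nonneg U k)
  simpa [enormSq, he] using hgoal

/-- **A sustained level floor costs energy hand-over** (HOME/LITERATURE.md §A22.71 (d)). Abstract
bookkeeping over `N` consecutive levels: coherences `φ_n ∈ (0, 1]` (band sup over its ceiling),
energy hand-overs `η_n ≥ 0`, a kinematic factor `κ` (`κ = λ⁻¹ √(M_{n+1}/M_n) ≈ λ^{1/2}`), and the
level steps `r_n` with `r_n² = κ² η_n (φ_{n+1}/φ_n)²`. If every step clears the floor, `r_n² ≥ 1`
for `n < N`, then `φ_0² ≤ (κ²)^N · Π_{n<N} η_n`: the geometric-mean hand-over is at least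
`κ⁻² φ_0^{2/N}` (→ `1/λ` for octave bands as `N → ∞`), because the coherence ratios telescope to
`φ_N/φ_0 ≤ 1/φ_0`. [derived — elementary] -/
theorem coherence_telescope {N : ℕ} {κ : ℝ} {φ η : ℕ → ℝ}
    (hφpos : ∀ n, 0 < φ n) (hφle : ∀ n, φ n ≤ 1) (hη : ∀ n, 0 ≤ η n)
    (hfloor : ∀ n < N, 1 ≤ κ ^ 2 * η n * (φ (n + 1) / φ n) ^ 2) :
    φ 0 ^ 2 ≤ (κ ^ 2) ^ N * ∏ n ∈ Finset.range N, η n := by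
  have key : ∀ K, K ≤ N → φ 0 ^ 2 ≤ (κ ^ 2) ^ K * (∏ n ∈ Finset.range K, η n) * φ K ^ 2 := by
    intro K
    induction K with
    | zero => intro _; simp
    | succ K ih =>
      intro hK
      have hK' : K < N := Nat.lt_of_succ_le hK
      have hprev := ih hK'.le
      have hstep : φ K ^ 2 ≤ κ ^ 2 * η K * φ (K + 1) ^ 2 := by
        have h1 := hfloor K hK'
        have hφK : 0 < φ K ^ 2 := pow_pos (hφpos K) 2
        have : κ ^ 2 * η K * (φ (K + 1) / φ K) ^ 2 = κ ^ 2 * η K * φ (K + 1) ^ 2 / φ K ^ 2 := by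
          rw [div_pow]; ring
        rw [this, le_div_iff₀ hφK, one_mul] at h1
        exact h1
      have hcoef : 0 ≤ (κ ^ 2) ^ K * ∏ n ∈ Finset.range K, η n :=
        mul_nonneg (pow_nonneg (sq_nonneg κ) K) (Finset.prod_nonneg fun n _ => hη n)
      calc φ 0 ^ 2 ≤ (κ ^ 2) ^ K * (∏ n ∈ Finset.range K, η n) * φ K ^ 2 := hprev
        _ ≤ (κ ^ 2) ^ K * (∏ n ∈ Finset.range K, η n) * (κ ^ 2 * η K * φ (K + 1) ^ 2) :=
            mul_le_mul_of_nonneg_left hstep hcoef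
        _ = (κ ^ 2) ^ (K + 1) * (∏ n ∈ Finset.range (K + 1), η n) * φ (K + 1) ^ 2 := by
            rw [Finset.prod_range_succ, pow_succ]; ring
  have hN := key N le_rfl
  have hφN : φ N ^ 2 ≤ 1 := by nlinarith [hφle N, (hφpos N).le]
  have hcoef : 0 ≤ (κ ^ 2) ^ N * ∏ n ∈ Finset.range N, η n :=
    mul_nonneg (pow_nonneg (sq_nonneg κ) N) (Finset.prod_nonneg fun n _ => hη n)
  calc φ 0 ^ 2 ≤ (κ ^ 2) ^ N * (∏ n ∈ Finset.range N, η n) * φ N ^ 2 := hN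
    _ ≤ (κ ^ 2) ^ N * (∏ n ∈ Finset.range N, η n) * 1 := mul_le_mul_of_nonneg_left hφN hcoef
    _ = (κ ^ 2) ^ N * ∏ n ∈ Finset.range N, η n := mul_one _

end Summit.NavierStokesRegularity.FluidComputer.BandSupCeiling

end
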